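import Summits.ResolutionOfSingularities.ResolutionOfSingularities.Theorems.HilbertSamuelEliminationSigmaMaxModificationsCorridor3WLadderIsoTailsBaseChangeMaximalIdealStalk
import Summits.ResolutionOfSingularities.ResolutionOfSingularities.Theorems.HilbertSamuelEliminationSigmaMaxModificationsCorridor3WLadderIsoProximityDefs
import Summits.ResolutionOfSingularities.ResolutionOfSingularities.Theorems.HilbertSamuelEliminationSigmaMaxModificationsCorridor3WLadderIsoTailsTowerBaseChangeDefs
import Mathlib.RingTheory.Flat.FaithfullyFlat.Algebra
import HarnessLib

/-!
# [OURS · L1 W4.2] K2-sep ROUTE A, brick (δ4, third part): **SATELLITE STEPS ARE INVARIANT UNDER GROUND-FIELD BASE CHANGE** — for the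
# base-changed tower `S_• = X_• ×_k K` (res-type-053's `bcX / bcι / bcπ` over `pr₁ : X_0 ×_k K → X_0`, `K/k` separable algebraic) and marked
# points `s_n ∈ S_n` with closed images `x_n = ι_n(s_n)`: `𝔪_{s_n}·𝒪_{s_{n+2}} ≠ 𝔪_{s_{n+1}}·𝒪_{s_{n+2}} ↔ 𝔪_{x_n}·𝒪_{x_{n+2}} ≠ 𝔪_{x_{n+1}}·𝒪_{x_{n+2}}`
# (`𝔪_{s_m} = 𝔪_{x_m}·𝒪_{s_m}`, the commuting squares `ι ∘ π′ = π ∘ ι` on stalks, and faithful flatness of `𝒪_{x_{n+2}} → 𝒪_{s_{n+2}}`)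
# (crux `SigmaMaxModifications` stmt-ResolutionOfSingularities-18506 / conjunct stmt-…-19249; line `w_ladder_rows` v8.5, registered stub
# `stub_isoSepRecurrent`; res-L1-w42-plan-1 WORD 2026-08-27T16:25:47Z; design `L/res-L1-w42-stub-2/k2sep/K2SEP-DESIGN.md` §8 (δ4))

Prover res-L1-w42-stub-2 (gen 5). Helper file `--supports stmt-ResolutionOfSingularities-19249 --as helper`; no definitions, no named fact. OURS
(cell res-hironaka, slot W4.2); NOT statements of [Hironaka2017] nor of [CossartJannsenSaito2020]. AI-written; AI review is weaker than expert
review. The left side is `IsSatelliteStep` of the base-changed tower (`BlowupTower.baseChangeGR`, definition file p561629) unfolded on 053's `bcπ`, so that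
this file does not wait for the definition review; the right side is `IsSatelliteStep T (fun m ↦ ι_m s_m) n` verbatim.

* `map_maximalIdeal_hom_of_iso` — an isomorphism of local rings maps `𝔪` onto `𝔪`.
* `eq_of_map_eq_of_flat_of_isLocalHom` — a flat local homomorphism of local rings reflects equality of extended ideals (faithful flatness).
* **`BlowupTower.isSatelliteStep_bc_iff_of_map_maximalIdeal`** (any flat `ι₀` with `𝔪 ↦ 𝔪` at points with closed image) and
  **`BlowupTower.isSatelliteStep_bc_iff`** (the ground-field case) — the satellite-step transfer.

[OURS · L1 W4.2; AI-written] [cite: CossartJannsenSaito2020, p. 107, Lemma 2.27 (1)] [cite: CossartPiltant2009, ch. 3 I.9]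
-/

set_option linter.dupNamespace false

noncomputable section

open CategoryTheory CategoryTheory.Limits AlgebraicGeometry TopologicalSpace IsLocalRing
open Literature.AlgebraicGeometry.Resolution Literature.AlgebraicGeometry.CossartJannsenSaito2020
open Summit.ResolutionOfSingularities.ResolutionOfSingularities.Cruxes.SigmaMaxModifications.IdeasL1C5

namespace Summit.ResolutionOfSingularities.ResolutionOfSingularities.Theorems.SigmaMaxModificationsCorridor3.IsoTailsHS

universe u

/-! ## §1. Two ring-theoretic helpers -/

/-- An isomorphism of (commutative, local) rings maps the maximal ideal ONTO the maximal ideal. [folklore] -/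
theorem map_maximalIdeal_hom_of_iso {A B : CommRingCat.{u}} [IsLocalRing A] [IsLocalRing B] (e : A ≅ B) :
    (maximalIdeal A).map e.hom.hom = maximalIdeal B := by
  have key : ∀ {C D : CommRingCat.{u}} [IsLocalRing C] [IsLocalRing D] (g : C ≅ D),
      (maximalIdeal C).map g.hom.hom ≤ maximalIdeal D := by
    intro C D _ _ g
    rw [Ideal.map_le_iff_le_comap]
    intro a ha
    rw [Ideal.mem_comap, mem_maximalIdeal, mem_nonunits_iff]
    intro hu
    apply (mem_maximalIdeal _).mp ha
    have : a = g.inv.hom (g.hom.hom a) := by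
      rw [← RingHom.comp_apply, ← CommRingCat.hom_comp, g.hom_inv_id, CommRingCat.hom_id, RingHom.id_apply]
    rw [this]
    exact hu.map g.inv.hom
  refine le_antisymm (key e) ?_
  calc maximalIdeal B = ((maximalIdeal B).map e.inv.hom).map e.hom.hom := by
          rw [Ideal.map_map, ← CommRingCat.hom_comp, e.inv_hom_id, CommRingCat.hom_id, Ideal.map_id]
    _ ≤ (maximalIdeal A).map e.hom.hom := Ideal.map_mono (key e.symm)

/-- A FLAT local homomorphism of local rings is faithfully flat, hence reflects equality of extended ideals. [folklore] -/
theorem eq_of_map_eq_of_flat_of_isLocalHom {A B : Type u} [CommRing A] [CommRing B] [IsLocalRing A] [IsLocalRing B] (φ : A →+* B)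
    [IsLocalHom φ] (hφ : φ.Flat) {I J : Ideal A} (h : I.map φ = J.map φ) : I = J := by
  letI := φ.toAlgebra
  haveI : Module.Flat A B := hφ
  haveI : IsLocalHom (algebraMap A B) := ‹IsLocalHom φ›
  haveI : Module.FaithfullyFlat A B := Module.FaithfullyFlat.of_flat_of_isLocalHom
  have hI := Ideal.comap_map_eq_self_of_faithfullyFlat (B := B) I
  have hJ := Ideal.comap_map_eq_self_of_faithfullyFlat (B := B) J
  change (I.map φ).comap φ = I at hI
  change (J.map φ).comap φ = J at hJ
  rw [← hI, ← hJ, h]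

/-! ## §2. Satellite steps along the base change of a tower -/

namespace BlowupTower

variable (T : BlowupTower.{u}) {k K : Type u} [Field k] [Field K] [Algebra k K] [Algebra.IsSeparable k K]
  (f : T.X 0 ⟶ Spec (CommRingCat.of k)) [LocallyOfFiniteType f]

/-- Transport of an extended maximal ideal along a commuting square of towers: if `g = ι ≫ q` as morphisms `S → X_n` (with `ι : S → X′`,
`q : X′ → X_n`), then for `z′ ∈ S`, `𝔪_{g z′}·𝒪_{S,z′}` (extension along `g`) equals `(𝔪_{q(ι z′)}·𝒪_{X′, ι z′})·𝒪_{S,z′}` (extension along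
`q` then `ι`). [folklore] -/
theorem map_maximalIdeal_stalkMap_comp_eq {S X' Y : Scheme.{u}} (g : S ⟶ Y) (ι : S ⟶ X') (q : X' ⟶ Y) (H : g = ι ≫ q) (z' : S) :
    (maximalIdeal (Y.presheaf.stalk (g.base z'))).map (g.stalkMap z').hom =
      ((maximalIdeal (Y.presheaf.stalk (q.base (ι.base z')))).map (q.stalkMap (ι.base z')).hom).map (ι.stalkMap z').hom := by
  rw [Scheme.Hom.stalkMap_congr_hom g (ι ≫ q) H z', CommRingCat.hom_comp, ← Ideal.map_map, map_maximalIdeal_hom_of_iso,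
    Ideal.map_map, ← CommRingCat.hom_comp, ← Scheme.Hom.stalkMap_comp]
  rfl

set_option maxHeartbeats 800000 in
-- stalk bookkeeping along two commuting squares
/-- **SATELLITE STEPS ALONG A FLAT BASE CHANGE OF A TOWER (generic form).** For the base change `S_•` of `T` along a flat `ι₀ : S₀ → X_0`
(res-type-053's `bcX / bcι / bcπ`), points `s_m ∈ S_m` with `x_{n+2} = ι_{n+2}(s_{n+2})` CLOSED, and the hypothesis that the comparison maps
satisfy `𝔪_{ι_m t}·𝒪_{S_m,t} = 𝔪_t` at points with closed image (`hm`; e.g. ground-field extensions, `map_maximalIdeal_stalkMap_bcι_eq`):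
`𝔪_{π′π′ s_{n+2}}·𝒪_{s_{n+2}} ≠ 𝔪_{π′ s_{n+2}}·𝒪_{s_{n+2}}` iff `IsSatelliteStep T (ι_• s_•) n`.
[cite: CossartJannsenSaito2020, p. 107] [cite: CossartPiltant2009, ch. 3 I.9] -/
theorem isSatelliteStep_bc_iff_of_map_maximalIdeal {S₀ : Scheme.{u}} (ι₀ : S₀ ⟶ T.X 0) [Flat ι₀]
    (hm : ∀ (m : ℕ) (t : ↥(T.bcX ι₀ m)), IsClosed ({(T.bcι ι₀ m).base t} : Set (T.X m)) →
      (maximalIdeal _).map ((T.bcι ι₀ m).stalkMap t).hom = maximalIdeal _)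
    (n : ℕ) (z' : ↥(T.bcX ι₀ (n + 2))) (hcl : IsClosed ({(T.bcι ι₀ (n + 2)).base z'} : Set (T.X (n + 2)))) :
    (Ideal.map ((T.bcπ ι₀ (n + 1) ≫ T.bcπ ι₀ n).stalkMap z').hom (maximalIdeal _) ≠
      Ideal.map ((T.bcπ ι₀ (n + 1)).stalkMap z').hom (maximalIdeal _)) ↔
    (Ideal.map ((T.π (n + 1) ≫ T.π n).stalkMap ((T.bcι ι₀ (n + 2)).base z')).hom (maximalIdeal _) ≠
      Ideal.map ((T.π (n + 1)).stalkMap ((T.bcι ι₀ (n + 2)).base z')).hom (maximalIdeal _)) := by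
  haveI : ∀ m, IsLocallyNoetherian (T.X m) := T.ln
  -- the images are closed (blow-ups are closed maps)
  have hclosed : ∀ {m : ℕ} (x : T.X (m + 1)), IsClosed ({x} : Set (T.X (m + 1))) → IsClosed ({(T.π m).base x} : Set (T.X m)) := by
    intro m x hx
    haveI : IsProper (T.π m) := (T.isBlowup m).isProper
    rw [← Set.image_singleton]
    exact (T.π m).isClosedMap _ hx
  have hc1 : IsClosed ({(T.π (n + 1)).base ((T.bcι ι₀ (n + 2)).base z')} : Set (T.X (n + 1))) := hclosed _ hcl
  have hc0 : IsClosed ({(T.π n).base ((T.π (n + 1)).base ((T.bcι ι₀ (n + 2)).base z'))} : Set (T.X n)) := hclosed _ hc1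
  -- the two commuting squares
  have H1 : T.bcπ ι₀ (n + 1) ≫ T.bcι ι₀ (n + 1) = T.bcι ι₀ (n + 2) ≫ T.π (n + 1) := (T.bcι_comp_π ι₀ (n + 1)).symm
  have H2 : (T.bcπ ι₀ (n + 1) ≫ T.bcπ ι₀ n) ≫ T.bcι ι₀ n = T.bcι ι₀ (n + 2) ≫ (T.π (n + 1) ≫ T.π n) := by
    rw [Category.assoc, ← T.bcι_comp_π ι₀ n, ← Category.assoc, H1, Category.assoc]
  -- the points downstairs
  have hp1 : (T.bcι ι₀ (n + 1)).base ((T.bcπ ι₀ (n + 1)).base z') = (T.π (n + 1)).base ((T.bcι ι₀ (n + 2)).base z') := by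
    rw [← Scheme.Hom.comp_apply, H1, Scheme.Hom.comp_apply]
  have hp2 : (T.bcι ι₀ n).base ((T.bcπ ι₀ (n + 1) ≫ T.bcπ ι₀ n).base z') =
      (T.π (n + 1) ≫ T.π n).base ((T.bcι ι₀ (n + 2)).base z') := by
    rw [← Scheme.Hom.comp_apply, H2, Scheme.Hom.comp_apply]
  -- `𝔪` upstairs is `𝔪` downstairs extended
  have hm2 := hm n ((T.bcπ ι₀ (n + 1) ≫ T.bcπ ι₀ n).base z') (by rw [hp2]; exact hc0)
  have hm1 := hm (n + 1) ((T.bcπ ι₀ (n + 1)).base z') (by rw [hp1]; exact hc1)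
  -- rewrite both upstairs ideals as extensions along `ι_{n+2}` of the downstairs ideals
  have E2 : Ideal.map ((T.bcπ ι₀ (n + 1) ≫ T.bcπ ι₀ n).stalkMap z').hom (maximalIdeal _) =
      (Ideal.map ((T.π (n + 1) ≫ T.π n).stalkMap ((T.bcι ι₀ (n + 2)).base z')).hom (maximalIdeal _)).map
        ((T.bcι ι₀ (n + 2)).stalkMap z').hom := by
    rw [← hm2, Ideal.map_map, ← CommRingCat.hom_comp, ← Scheme.Hom.stalkMap_comp]
    exact map_maximalIdeal_stalkMap_comp_eq _ _ _ H2 z'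
  have E1 : Ideal.map ((T.bcπ ι₀ (n + 1)).stalkMap z').hom (maximalIdeal _) =
      (Ideal.map ((T.π (n + 1)).stalkMap ((T.bcι ι₀ (n + 2)).base z')).hom (maximalIdeal _)).map
        ((T.bcι ι₀ (n + 2)).stalkMap z').hom := by
    rw [← hm1, Ideal.map_map, ← CommRingCat.hom_comp, ← Scheme.Hom.stalkMap_comp]
    exact map_maximalIdeal_stalkMap_comp_eq _ _ _ H1 z'
  -- faithful flatness of `𝒪_{x_{n+2}} → 𝒪_{s_{n+2}}`
  haveI : Flat (T.bcι ι₀ (n + 2)) := T.flat_bcι ι₀ (n + 2)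
  have hflat : ((T.bcι ι₀ (n + 2)).stalkMap z').hom.Flat := Flat.stalkMap (T.bcι ι₀ (n + 2)) z'
  rw [E1, E2]
  constructor
  · intro h heq
    exact h (by rw [heq])
  · intro h heq
    exact h (eq_of_map_eq_of_flat_of_isLocalHom _ hflat heq)

/-- **SATELLITE STEPS ARE INVARIANT UNDER GROUND-FIELD BASE CHANGE.** For the base change `S_•` of `T` along `pr₁ : X_0 ×_k K → X_0` (`K/k`
separable algebraic, `X_0 → Spec k` locally of finite type) and points `s_m ∈ S_m` whose image `x_{n+2} = ι_{n+2}(s_{n+2})` is CLOSED: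
`𝔪_{π′π′ s_{n+2}}·𝒪_{s_{n+2}} ≠ 𝔪_{π′ s_{n+2}}·𝒪_{s_{n+2}}` (`IsSatelliteStep` of the base-changed tower, unfolded on 053's `bcπ`)
iff `IsSatelliteStep T (ι_• s_•) n`. [cite: CossartJannsenSaito2020, p. 107] [cite: CossartPiltant2009, ch. 3 I.9] -/
theorem isSatelliteStep_bc_iff (n : ℕ) (s : ∀ m, ↥(T.bcX (pullback.fst f (Spec.map (CommRingCat.ofHom (algebraMap k K)))) m))
    (hcl : IsClosed ({(T.bcι (pullback.fst f (Spec.map (CommRingCat.ofHom (algebraMap k K)))) (n + 2)).base (s (n + 2))} : Set (T.X (n + 2)))) :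
    (Ideal.map (((T.bcπ (pullback.fst f (Spec.map (CommRingCat.ofHom (algebraMap k K)))) (n + 1)) ≫
          T.bcπ (pullback.fst f (Spec.map (CommRingCat.ofHom (algebraMap k K)))) n).stalkMap (s (n + 2))).hom (maximalIdeal _) ≠
      Ideal.map ((T.bcπ (pullback.fst f (Spec.map (CommRingCat.ofHom (algebraMap k K)))) (n + 1)).stalkMap (s (n + 2))).hom
        (maximalIdeal _)) ↔
    IsSatelliteStep T (fun m => (T.bcι (pullback.fst f (Spec.map (CommRingCat.ofHom (algebraMap k K)))) m).base (s m)) n := by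
  haveI : Flat (Spec.map (CommRingCat.ofHom (algebraMap k K))) := by
    rw [HasRingHomProperty.Spec_iff (P := @Flat), CommRingCat.hom_ofHom, RingHom.flat_algebraMap_iff]
    infer_instance
  haveI : Flat (pullback.fst f (Spec.map (CommRingCat.ofHom (algebraMap k K)))) := inferInstance
  exact isSatelliteStep_bc_iff_of_map_maximalIdeal T _ (fun m t ht => map_maximalIdeal_stalkMap_bcι_eq T f m ht) n (s (n + 2)) hcl

/-- **`IsSatelliteStep (T ×_k K) s n ↔ IsSatelliteStep T (ι_• s_•) n`** — the same, for the packaged base-changed tower `BlowupTower.baseChangeGR`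
(definition file `…IsoTailsTowerBaseChangeDefs`). [cite: CossartJannsenSaito2020, p. 107] [cite: CossartPiltant2009, ch. 3 I.9] -/
theorem isSatelliteStep_baseChangeGR_iff [IsSeparated f] (n : ℕ)
    (s : ∀ m, ↥(T.bcX (pullback.fst f (Spec.map (CommRingCat.ofHom (algebraMap k K)))) m))
    (hcl : IsClosed ({(T.bcι (pullback.fst f (Spec.map (CommRingCat.ofHom (algebraMap k K)))) (n + 2)).base (s (n + 2))} : Set (T.X (n + 2)))) :
    (by
      haveI := geometricallyReduced_SpecMap_algebraMap_of_isSeparable k K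
      haveI : Flat (Spec.map (CommRingCat.ofHom (algebraMap k K))) := by
        rw [HasRingHomProperty.Spec_iff (P := @Flat), CommRingCat.hom_ofHom, RingHom.flat_algebraMap_iff]; infer_instance
      haveI : IsLocallyNoetherian (T.X 0) := T.ln 0
      haveI := isLocallyNoetherian_pullback_SpecMap (K := K) f
      exact IsSatelliteStep (baseChangeGR T (pullback.fst f (Spec.map (CommRingCat.ofHom (algebraMap k K))))) s n) ↔
    IsSatelliteStep T (fun m => (T.bcι (pullback.fst f (Spec.map (CommRingCat.ofHom (algebraMap k K)))) m).base (s m)) n :=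
  isSatelliteStep_bc_iff T f n s hcl

end BlowupTower

end Summit.ResolutionOfSingularities.ResolutionOfSingularities.Theorems.SigmaMaxModificationsCorridor3.IsoTailsHS

end
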